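import Summits.MatrixMultiplication.MatrixMultiplication.Theses.FourierTwoFamiliesModP
import HarnessLib.Audit

/-!
# Line `sos-flatness-certificate` — skeleton for crux `FourierTwoFamiliesModP.PrimeCyclicPowerGain`
(item stmt-MatrixMultiplication-14309, route route-MatrixMultiplication-FourierTwoFamiliesModP; crux-plan, round 1)

Idea (crux idea card `Cruxes/PrimeCyclicPowerGain/Ideas/sos-flatness-certificate.md`, ideator k = 1; triage
r1-1 / r1-2 / r1-3: **pass / pass / pass**, all "with doubt": no candidate dual, the card's hand-picked partial
relaxation is weaker than level 2, collapse-to-level-1 untested; merge note ≈ `clique-coclique-direct-sum-clique` (iii)).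

**The line.** Work in the 2D CELL system of the card: a balanced SDPP configuration `(A_j, B_j)_{j<n}` in `G = ZMod p`
is the same thing as its cell set `Π = ⊔_j A_j × B_j ⊆ G × G` — `n` disjoint combinatorial `s × s` rectangles with
pairwise disjoint row supports and column supports — subject to two local laws: DIRECTNESS (W) = "two distinct
cells of one rectangle never lie on a common diagonal `a − b = const` nor on a common anti-diagonal `a + b = const`",
and the ZONE LAW (X) = "`(X × Y) ∩ (Π + Δ) = Π`", i.e. the Horn clause `(a,b̃), (ã,b), (a−t,b−t) ∈ Π ⇒ (a,b) ∈ Π`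
(`stub_cells`, the card's `ZoneIdentity`/`SquareDiagonal` dictionary, provable now). The whole crux is then a
statement about 0/1 points of an explicit polynomial system in the Boolean cell variables `π_c, c ∈ G × G`, invariant
under the affine group `(a,b) ↦ (λa + g, λb + h)`. The TRANSFER `C⁺` of the line is the fixed-level Lasserre /
sum-of-squares statement in PSEUDO-MOMENT form: a set-function `μ : Finset (G×G) → ℝ` (`μ S` = pseudo-moment of
`∏_{c∈S} π_c`) which is positive semidefinite at level `d` (moment matrix and the localising matrices of `0 ≤ π_c ≤ 1`
and of the LINE CUTS "every diagonal / anti-diagonal line carries ≤ n cells of Π" — the degree-1 form of the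
route's `D̃ ≤ n` — and "every row / column carries ≤ s cells"), and satisfies the linearised rectangle / directness / zone / balance / size axioms on all shift
sets of `≤ 2d` cells (`Feasible d p n s μ`). `stub_moments` (provable now): the true moment function
`S ↦ [S ⊆ Π]` of a good cell set is feasible at EVERY level (Gram identity `Σ f S f T [S∪T ⊆ Π] = (Σ_{S⊆Π} f S)²`,
`(n − #cells on the line)·(Σ f)² ≥ 0`, `(s − #cells in the row)·(Σ f)² ≥ 0`, and the dictionary's closure properties). `stub_sos` (THE BET, open):
some fixed level `d` certifies a power saving — every feasible `μ` has `n · s^{1+c} ≤ C · p` — i.e. bounded-degree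
SoS "sees" the block size `s` (the card: the first `s`-sensitive information is degree 4: `auto_{A_j}·auto_{B_j} = s²δ₀`,
`Ŵ ≥ 0` vanishing on the punctured diagonal, `W(0,0)/F(0) = s`). The glue `PrimeCyclicPowerGain_of` is a real proof:
dictionary → feasibility → bound `n s^{1+c} ≤ C p` → absorb `C` into `s^{c/2}` beyond a threshold `s₀`
(`tendsto_rpow_atTop`), concluding the crux BY NAME with exponent `c/2`.

Why this shape and not the card's list `F, G, R, S, W, C, D̃`: in that hand-picked partial relaxation the only
`s`-sensitive datum (`W ≥ 0`, `Ŵ ≥ 0`, `W = 0` on the punctured diagonal, marginals `s²F`, `s²G`) is DECOUPLED from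
the density constraints — `W := n · (auto_{A₀} ⊗ auto_{B₀})`, `F := n · auto_{A₀}`, `G := n · auto_{B₀}` for ONE direct
pair `(A₀, B₀)` satisfy all of them for every `n` — so what remains coupled to `n` is the level-1 system in `C, D̃, R, S`,
whose value is HalfDensity's `≈ p(s+1)/(2s²)`; `stub_sos` stated for that list would almost surely be false (triage
r1-1: "hand-picked partial relaxation, weaker than level 2"). The pseudo-moment system below is instead the full
level-`d` relaxation of the exact cell system (its 0/1 solutions are exactly the balanced SDPP configurations with
`n` blocks of size `s`), so `stub_sos` is precisely "bounded-degree SoS proves the crux": strictly stronger than the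
crux (refutable by a pseudo-moment construction without touching the crux), finite and convex for each `(p, s, n)`
(an SDP — the experiment), TRUE whenever the crux has an elementary bounded-depth Cauchy–Schwarz / incidence proof
(such proofs are bounded-degree SoS certificates), and in doubt exactly when only density-increment (log-type,
unbounded-degree) arguments exist — the dichotomy named in the item's why-might-fail.

## Stubs (3) and glue
* `stub_cells` (M, provable now) — `CellDictionary`: balanced + (W) + (X) ⇒ `GoodCells p n s (cells A B)`
  (rectangle closure, row/column counts `s`, `|Π| = n s²`, directness on diagonals and anti-diagonals, zone Horn
  clause, line cuts `≤ n`). Tree: `IsSDPP.pairwiseDisjoint`-style disjointness is re-derived from (X) (needs `s ≥ 1`,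
  vacuous at `s = 0`).
* `stub_moments` (M, provable now) — `MomentFeasibility`: `GoodCells p n s Π ⇒ ∀ d, Feasible d p n s (trueMoment Π)`.
* `stub_sos` (XL, load-bearing, the bet / transfer `C⁺`) — `PseudoMomentBound`:
  `∃ d C c, 0 < c ∧ ∀ p prime, ∀ n s μ, Feasible d p n s μ → n·s^{1+c} ≤ C·p`.
* Glue (sorry-free): `of_stubs` (the composition with the three statements as hypotheses, conclusion = the crux
  formula verbatim), `PrimeCyclicPowerGain_of : FourierTwoFamiliesModP.PrimeCyclicPowerGain` (concludes the crux by
  name), `pseudoMomentBound_of_levelTwo` (the card's literal level-2 claim implies the stub).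
* Waypoints (documented targets, NOT registered stubs): `LevelTwoBound` (card's claim, the experiment's object),
  `SoSHalfDensity` (calibration: the relaxation reproduces the route's `HalfDensity`, `2ns² ≤ p(s+1)`; provable now,
  and the first thing any numerical run must reproduce).

## Disproof.lean obligations honoured
`payload.disproof_path` (`run/gate/evidence/stmt-MatrixMultiplication-14309/20260815T230135Z-Disproof.lean`) is OFF-BOX
on this hub (not mounted; `ledger crux cat stmt-MatrixMultiplication-14309 Disproof.lean` = no workfile; the three
triagers record the same); nothing has landed under `Theorems/PrimeCyclicPowerGain/Negative/` (nothing to import).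
Used: the v1–v3 evidence NOTES on the item. `false_without_W` — (W) is consumed by `stub_cells` (fields `direct`,
`diagCut`, `antiCut`) and is load-bearing in `Feasible` (drop `direct` + cuts and `A = B = ZMod p`, `n = 1`, `s = p`
is feasible, killing `stub_sos`); `false_without_X` — (X) is consumed by `stub_cells` (field `zone`, and the
disjointness behind `rect`/`row`/`col`) and is load-bearing in `Feasible.zone` (without it the density-1/4
disjointness-only family's true moments are feasible for all `s`); `false_without_balanceB` — balance is `row`/`col`;
`primeCyclicPowerGain_iff_thresholdFree` — `stub_sos` has NO threshold (`s₀` enters only in the glue, to absorb `C`);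
`primeCyclicPowerGain_iff_cyclicPowerGain` — `stub_cells`/`stub_moments` are modulus-agnostic (`[NeZero p]`), only
`stub_sos` keeps `p.Prime` (as a usable hypothesis: dilation symmetry of the dual); `Digit.digit_design` /
`not_powerGainAt_of_large` and `translate_wall` — digit designs and translates are 0/1 feasible points
(`stub_moments`), so any proof of `stub_sos` necessarily has `c < 0.546` and `C ≥ 1`; no stub is an instance of a
refuted strengthening (the wall `n s² ≤ C p`, refuted by p69024, is NOT asserted: `stub_sos` allows any `c < 1`).
-/

set_option linter.dupNamespace false

noncomputable section

open scoped BigOperators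

namespace Summit.MatrixMultiplication.MatrixMultiplication.Cruxes.PrimeCyclicPowerGain.SosFlatnessCertificate

/-! ### The 2D cell dictionary (card: `Π = ⊔ A_j × B_j ⊆ (ℤ/p)²`, `(W) ⟺ Π_j Δ-direct`, `(X) ⟺ (X×Y)∩(Π+Δ) = Π`) -/

/-- A cell of the `p × p` board `G × G`, `G = ZMod p` (first coordinate: the `A`-side, second: the `B`-side). -/
abbrev Cell (p : ℕ) := ZMod p × ZMod p

/-- The cell set `Π = ⋃_j A_j × B_j` of a configuration. -/
def cells {p n : ℕ} (A B : Fin n → Finset (ZMod p)) : Finset (Cell p) :=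
  (Finset.univ : Finset (Fin n)).biUnion fun j => (A j) ×ˢ (B j)

/-- The TRUE moment function of a cell set: `S ↦ [S ⊆ Π]` (the moments `E ∏_{c∈S} π_c` of the 0/1 point `π = 1_Π`). -/
def trueMoment {p : ℕ} (P : Finset (Cell p)) (S : Finset (Cell p)) : ℝ :=
  if S ⊆ P then 1 else 0

/-- GOOD CELL SETS: the set-theoretic normal form of a balanced SDPP configuration with `n` blocks of size `s`
(exactly the 0/1 solutions of the cell system). `rect`: rows sharing a cell span the same rectangle;
`row`/`col`: a non-empty row/column of `Π` has exactly `s` cells; `size`: `|Π| = n s²`; `direct` = (W): two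
distinct cells of one rectangle (same rectangle is witnessed by the corner `(a, b')`) are never on a common
anti-diagonal `a + b = a' + b'` (sums distinct) nor on a common diagonal `a − b = a' − b'` (differences distinct);
`zone` = (X): `(a,b̃), (ã,b), (a−t,b−t) ∈ Π ⇒ (a,b) ∈ Π`; `diagCut`/`antiCut`: a diagonal line `{(a, a − z)}`
resp. anti-diagonal line `{(a, z − a)}` meets each rectangle at most once, hence carries `≤ n` cells
(the degree-≤ 1 form of the route's `D̃ ≤ n`). -/
structure GoodCells (p : ℕ) [NeZero p] (n s : ℕ) (P : Finset (Cell p)) : Prop where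
  rect : ∀ a a' b b' : ZMod p, (a, b) ∈ P → (a, b') ∈ P → (a', b) ∈ P → (a', b') ∈ P
  row : ∀ a b' : ZMod p, (a, b') ∈ P → (Finset.univ.filter fun b : ZMod p => (a, b) ∈ P).card = s
  col : ∀ a' b : ZMod p, (a', b) ∈ P → (Finset.univ.filter fun a : ZMod p => (a, b) ∈ P).card = s
  size : P.card = n * s ^ 2
  direct : ∀ a b a' b' : ZMod p, (a, b) ≠ (a', b') → (a + b = a' + b' ∨ a - b = a' - b') →
    (a, b) ∈ P → (a', b') ∈ P → (a, b') ∈ P → False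
  zone : ∀ a b a'' b'' t : ZMod p, (a, b'') ∈ P → (a'', b) ∈ P → (a - t, b - t) ∈ P → (a, b) ∈ P
  diagCut : ∀ z : ZMod p, (Finset.univ.filter fun a : ZMod p => (a, a - z) ∈ P).card ≤ n
  antiCut : ∀ z : ZMod p, (Finset.univ.filter fun a : ZMod p => (a, z - a) ∈ P).card ≤ n

/-! ### The level-`d` pseudo-moment relaxation (Lasserre / sum-of-squares, primal form) -/

/-- LEVEL-`d` PSEUDO-MOMENTS for the cell system with parameters `(p, n, s)`: a set-function `μ` on finite sets of
cells (`μ S` plays `Ẽ[∏_{c∈S} π_c]`; Booleanity is built in) such that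
* `norm`, `nonneg`, `mono`: `μ ∅ = 1`, `0 ≤ μ`, `μ` antitone, on the window of `≤ 2d + 4` cells;
* `psd`: the moment matrix `(μ (S ∪ T))_{|S|,|T| ≤ d}` is positive semidefinite; `psdIn`/`psdOut`: so are the
  localising matrices of `π_c ≥ 0` and `1 − π_c ≥ 0`;
* `rect`, `direct`, `zone`, `row`, `col`, `size`: the axioms of `GoodCells`, multiplied by every monomial
  `∏_{c∈S} π_c` with `|S| ≤ 2d` (Horn clauses `c₁c₂c₃ ⇒ c₄` as `μ(S ∪ 3 cells) = μ(S ∪ 4 cells)`, vanishing laws as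
  `μ(S ∪ 3 cells) = 0`, counting laws as linear identities);
* `diagCut`/`antiCut`: the localising matrices of the LINE CUTS `n − #{cells of Π on a (anti-)diagonal line} ≥ 0`;
  `rowCut`/`colCut`: likewise for `s − #{cells of Π in a row / column} ≥ 0` (a row meets at most one rectangle).
Every constraint is affine in `μ` or a PSD condition on an affine image of `μ`: for fixed `(d, p, n, s)` feasibility
is a semidefinite program, invariant under `(a,b) ↦ (λa + g, λb + h)`, `λ ∈ (ZMod p)ˣ` (so dual certificates may be
taken invariant: 2-cell kernels are functions of the slope `[a'−a : b'−b] ∈ P¹(𝔽_p)`). -/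
structure Feasible (d : ℕ) (p : ℕ) [NeZero p] (n s : ℕ) (μ : Finset (Cell p) → ℝ) : Prop where
  norm : μ ∅ = 1
  nonneg : ∀ S : Finset (Cell p), S.card ≤ 2 * d + 4 → 0 ≤ μ S
  mono : ∀ S T : Finset (Cell p), T.card ≤ 2 * d + 4 → S ⊆ T → μ T ≤ μ S
  psd : ∀ f : Finset (Cell p) → ℝ, (∀ S, d < S.card → f S = 0) →
    0 ≤ ∑ S : Finset (Cell p), ∑ T : Finset (Cell p), f S * f T * μ (S ∪ T)
  psdIn : ∀ (c : Cell p) (f : Finset (Cell p) → ℝ), (∀ S, d < S.card → f S = 0) →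
    0 ≤ ∑ S : Finset (Cell p), ∑ T : Finset (Cell p), f S * f T * μ (insert c (S ∪ T))
  psdOut : ∀ (c : Cell p) (f : Finset (Cell p) → ℝ), (∀ S, d < S.card → f S = 0) →
    0 ≤ ∑ S : Finset (Cell p), ∑ T : Finset (Cell p), f S * f T * (μ (S ∪ T) - μ (insert c (S ∪ T)))
  rect : ∀ (a a' b b' : ZMod p) (S : Finset (Cell p)), S.card ≤ 2 * d →
    μ (insert (a, b) (insert (a, b') (insert (a', b) S))) =
      μ (insert (a', b') (insert (a, b) (insert (a, b') (insert (a', b) S))))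
  direct : ∀ (a b a' b' : ZMod p) (S : Finset (Cell p)), S.card ≤ 2 * d → (a, b) ≠ (a', b') →
    (a + b = a' + b' ∨ a - b = a' - b') → μ (insert (a, b) (insert (a', b') (insert (a, b') S))) = 0
  zone : ∀ (a b a'' b'' t : ZMod p) (S : Finset (Cell p)), S.card ≤ 2 * d →
    μ (insert (a, b'') (insert (a'', b) (insert (a - t, b - t) S))) =
      μ (insert (a, b) (insert (a, b'') (insert (a'', b) (insert (a - t, b - t) S))))
  row : ∀ (a b' : ZMod p) (S : Finset (Cell p)), S.card ≤ 2 * d →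
    ∑ b : ZMod p, μ (insert (a, b) (insert (a, b') S)) = s * μ (insert (a, b') S)
  col : ∀ (a' b : ZMod p) (S : Finset (Cell p)), S.card ≤ 2 * d →
    ∑ a : ZMod p, μ (insert (a, b) (insert (a', b) S)) = s * μ (insert (a', b) S)
  size : ∀ S : Finset (Cell p), S.card ≤ 2 * d → ∑ c : Cell p, μ (insert c S) = n * s ^ 2 * μ S
  diagCut : ∀ (z : ZMod p) (f : Finset (Cell p) → ℝ), (∀ S, d < S.card → f S = 0) →
    0 ≤ ∑ S : Finset (Cell p), ∑ T : Finset (Cell p),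
      f S * f T * (n * μ (S ∪ T) - ∑ a : ZMod p, μ (insert (a, a - z) (S ∪ T)))
  antiCut : ∀ (z : ZMod p) (f : Finset (Cell p) → ℝ), (∀ S, d < S.card → f S = 0) →
    0 ≤ ∑ S : Finset (Cell p), ∑ T : Finset (Cell p),
      f S * f T * (n * μ (S ∪ T) - ∑ a : ZMod p, μ (insert (a, z - a) (S ∪ T)))
  rowCut : ∀ (a : ZMod p) (f : Finset (Cell p) → ℝ), (∀ S, d < S.card → f S = 0) →
    0 ≤ ∑ S : Finset (Cell p), ∑ T : Finset (Cell p),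
      f S * f T * (s * μ (S ∪ T) - ∑ b : ZMod p, μ (insert (a, b) (S ∪ T)))
  colCut : ∀ (b : ZMod p) (f : Finset (Cell p) → ℝ), (∀ S, d < S.card → f S = 0) →
    0 ≤ ∑ S : Finset (Cell p), ∑ T : Finset (Cell p),
      f S * f T * (s * μ (S ∪ T) - ∑ a : ZMod p, μ (insert (a, b) (S ∪ T)))

/-! ### The three stub statements -/

/-- CELL DICTIONARY (stub 1): a balanced configuration with (W) and (X) — hypotheses verbatim those of the crux —
has a good cell set. -/
def CellDictionary : Prop :=
  ∀ (p : ℕ) [NeZero p] (n s : ℕ) (A B : Fin n → Finset (ZMod p)),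
    (∀ i : Fin n, (A i).card = s ∧ (B i).card = s) →
    (∀ i : Fin n, ∀ a ∈ A i, ∀ a' ∈ A i, ∀ b ∈ B i, ∀ b' ∈ B i, (a - a') + (b - b') = 0 → a = a' ∧ b = b') →
    (∀ i j k : Fin n, ∀ a ∈ A i, ∀ a' ∈ A j, ∀ b ∈ B j, ∀ b' ∈ B k, (a - a') + (b - b') = 0 → i = k) →
    GoodCells p n s (cells A B)

/-- MOMENT FEASIBILITY (stub 2, soundness of the relaxation): the true moment function of a good cell set is a
feasible level-`d` pseudo-moment function for every `d`. -/
def MomentFeasibility : Prop :=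
  ∀ (p : ℕ) [NeZero p] (n s : ℕ) (P : Finset (Cell p)), GoodCells p n s P →
    ∀ d : ℕ, Feasible d p n s (trueMoment P)

/-- PSEUDO-MOMENT BOUND (stub 3, THE BET — transfer `C⁺`, "bounded-degree SoS certifies a power saving"):
some fixed level `d` and constants `C`, `c > 0` such that for every prime `p` and all `n, s`, every feasible level-`d`
pseudo-moment function forces `n · s^{1+c} ≤ C · p`. No threshold in `s` (Disproof: `s₀` is not load-bearing);
digit designs are feasible 0/1 points, so necessarily `c < 0.546`. -/
def PseudoMomentBound : Prop :=
  ∃ d : ℕ, ∃ C c : ℝ, 0 < c ∧ ∀ (p : ℕ) [NeZero p], p.Prime → ∀ (n s : ℕ) (μ : Finset (Cell p) → ℝ),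
    Feasible d p n s μ → (n : ℝ) * (s : ℝ) ^ (1 + c) ≤ C * p

/-! ### Waypoints (documented targets; not registered stubs) -/

/-- WAYPOINT — the card's literal claim (level 2 = "degree 4"): the object of the cheapest falsifier. -/
def LevelTwoBound : Prop :=
  ∃ C c : ℝ, 0 < c ∧ ∀ (p : ℕ) [NeZero p], p.Prime → ∀ (n s : ℕ) (μ : Finset (Cell p) → ℝ),
    Feasible 2 p n s μ → (n : ℝ) * (s : ℝ) ^ (1 + c) ≤ C * p

/-- WAYPOINT — calibration (provable now, M): at some fixed level the relaxation reproduces the route's level-1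
support `HalfDensity`, `2 n s² ≤ p (s + 1)` (zone summed: `⟨C, D̃⟩ = Σ D̃²`; line cut: `Σ D̃² ≤ n Σ D̃`;
`‖u ∗ ṽ‖_∞ ≤ ‖u‖₂‖v‖₂` as the degree-2 SoS inequality `−2(u∗ṽ)(z) ≤ Σ u² + Σ v²` with `Σ_a x_a = ns` exact).
Any numerical run of the relaxation must reproduce this value before its `s`-dependence is read. -/
def SoSHalfDensity : Prop :=
  ∃ d : ℕ, ∀ (p : ℕ) [NeZero p], p.Prime → ∀ (n s : ℕ) (μ : Finset (Cell p) → ℝ), 1 ≤ s →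
    Feasible d p n s μ → 2 * (n : ℝ) * (s : ℝ) ^ 2 ≤ (p : ℝ) * ((s : ℝ) + 1)

/-- The card's level-2 claim implies the registered bet. -/
theorem pseudoMomentBound_of_levelTwo (h : LevelTwoBound) : PseudoMomentBound := by
  obtain ⟨C, c, hc, h⟩ := h
  exact ⟨2, C, c, hc, h⟩

/-! ### The three registered stubs -/

/-- **Stub 1 — the cell dictionary (M, provable now).** `CellDictionary`. Why true: with `s ≥ 1`, (X) forces the
`A_i` pairwise disjoint and the `B_i` pairwise disjoint (take `j = i`, `a' = a`, `b = b' ∈ B_i`), so `Π = ⊔ A_j × B_j`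
is a disjoint union of rectangles with disjoint row/column supports: `rect`, `row`, `col`, `size` (`Finset.card_biUnion`,
`Finset.card_product`); `direct`: the corner `(a,b')` puts both cells in one rectangle `A_i × B_i`, and (W) applied to
the pairing `(a − a') + (b' − b) = 0` resp. `(a − a') + (b − b') = 0` gives `a = a'`, `b = b'`; `zone`: (X) with
`x = a ∈ A_i`, `x' = a − t ∈ A_j`, `y = b − t ∈ B_j`, `y' = b ∈ B_k` gives `i = k`, so `(a,b) ∈ A_i × B_i`; the cuts:
two cells of one rectangle on a line `{(a, a−z)}` / `{(a, z−a)}` differ by a diagonal / lie on an anti-diagonal, excluded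
by `direct`, and there are `n` rectangles (`s = 0`: everything is empty). Tree: `Literature…IsSDPP` API
(`isSDPP_iff`, `IsSDPP.pairwiseDisjoint`, `card_mul_card_le`) may be reused after rewriting the hypotheses. -/
theorem stub_cells : CellDictionary := by
  sorry

/-- **Stub 2 — soundness of the relaxation (M, provable now).** `MomentFeasibility`. Why true: for `μ = trueMoment Π`,
`Σ_{S,T} f S f T μ(S ∪ T) = (Σ_{S ⊆ Π} f S)² ≥ 0` (`Finset.subset_union…`, `Finset.sum_mul_sum`, `sq_nonneg`);
`psdIn`/`psdOut` are the same square times `[c ∈ Π]`, `1 − [c ∈ Π]`; `diagCut`/`antiCut` are the same square times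
`n − #{a : (a, a∓z) ∈ Π} ≥ 0` (`GoodCells.diagCut/antiCut`), `rowCut`/`colCut` the same square times `s − (0 or s) ≥ 0`
(`GoodCells.row/col`); `rect`/`zone`/`direct` are `GoodCells.rect/zone/direct`
read through `[insert … ⊆ Π] = [cells ∈ Π] · [S ⊆ Π]` (`Finset.insert_subset_iff`); `row`/`col`/`size` are
`GoodCells.row/col/size` (`Finset.sum_boole`, `Finset.filter` cardinalities); `norm`/`nonneg`/`mono` are immediate. -/
theorem stub_moments : MomentFeasibility := by
  sorry

/-- **Stub 3 — THE BET (XL, load-bearing): bounded-degree SoS certifies a power saving.** `PseudoMomentBound`.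
Why plausible: the 0/1 solutions of the cell system are exactly the balanced SDPP configurations, so the statement is
the crux strengthened from "true" to "provable by a fixed-degree positivity certificate"; every elementary
bounded-depth Cauchy–Schwarz / incidence proof of a power saving IS such a certificate, and degree 4 is known to gain
polynomially over the spectral bound in a pseudorandom additive packing problem (Paley clique number, `p^{1/2} → p^{1/3}`,
Kunisky–Yu 2023, triage r1-3). The dual certificate to be found is a family, uniform in `p`, of affine-invariant
positive semidefinite kernels on `≤ d`-sets of cells (2-cell part: a function of the slope in `P¹(𝔽_p)`) pairing the
axioms `direct` (the card's flatness `auto_A · auto_B = s² δ₀`), `zone`, `row/col/size` and the line cuts against the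
moment matrix. How it dies: a level-`d` feasible `μ_{p,s}` with `n s /p ≥ ε₀` for all `s` (collapse to level 1), for
every `d` — first test: the level-2 SDP at small `p` (cheapest falsifier in the line card). Necessarily `c < 0.546`
(digit designs) and the value at `s = 2` is `⌊p/4⌋` (HalfDensity tight). -/
theorem stub_sos : PseudoMomentBound := by
  sorry

/-! ### Glue (sorry-free) -/

/-- From a bound `n · s^{1+c} ≤ C · p` to `n · s^{1+c/2} ≤ p` once `C ≤ s^{c/2}`. -/
theorem absorb_constant (n s p : ℕ) (C c : ℝ) (hs : 1 ≤ s) (hC : C ≤ (s : ℝ) ^ (c / 2))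
    (h : (n : ℝ) * (s : ℝ) ^ (1 + c) ≤ C * p) : (n : ℝ) * (s : ℝ) ^ (1 + c / 2) ≤ p := by
  have hs' : (0 : ℝ) < s := by exact_mod_cast hs
  have hpow : 0 < (s : ℝ) ^ (c / 2) := Real.rpow_pos_of_pos hs' _
  have hsplit : (s : ℝ) ^ (1 + c) = (s : ℝ) ^ (1 + c / 2) * (s : ℝ) ^ (c / 2) := by
    rw [← Real.rpow_add hs']; ring_nf
  have key : (n : ℝ) * (s : ℝ) ^ (1 + c / 2) * (s : ℝ) ^ (c / 2) ≤ (p : ℝ) * (s : ℝ) ^ (c / 2) := by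
    calc (n : ℝ) * (s : ℝ) ^ (1 + c / 2) * (s : ℝ) ^ (c / 2) = (n : ℝ) * (s : ℝ) ^ (1 + c) := by
          rw [hsplit]; ring
      _ ≤ C * p := h
      _ ≤ (s : ℝ) ^ (c / 2) * p := by gcongr
      _ = (p : ℝ) * (s : ℝ) ^ (c / 2) := by ring
  exact le_of_mul_le_mul_right key hpow

/-- A threshold beyond which `s^{c/2}` dominates a given constant. -/
theorem exists_threshold (C c : ℝ) (hc : 0 < c) :
    ∃ s₁ : ℕ, ∀ s : ℕ, s₁ ≤ s → C ≤ (s : ℝ) ^ (c / 2) := by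
  have ht : Filter.Tendsto (fun x : ℝ => x ^ (c / 2)) Filter.atTop Filter.atTop :=
    tendsto_rpow_atTop (by linarith)
  obtain ⟨a, ha⟩ := Filter.eventually_atTop.1 (Filter.tendsto_atTop.1 ht C)
  refine ⟨⌈a⌉₊, fun s hs => ha s ?_⟩
  exact le_trans (Nat.le_ceil a) (by exact_mod_cast hs)

/-- **The composition** (kernel-checked reduction of the crux to the three stub statements): cell dictionary →
feasibility of the true moments at the level `d` of the bet → `n · s^{1+c} ≤ C · p` for every balanced SDPP
configuration in `ZMod p` → absorb `C` into `s^{c/2}` beyond `s₀ := max 1 ⌈threshold⌉`. The conclusion is the text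
of `FourierTwoFamiliesModP.PrimeCyclicPowerGain` verbatim (exponent `c/2`). Uses of the crux hypotheses: balance,
(W), (X) all enter `stub_cells`; primality enters `stub_sos`; `s₀ ≤ s` only absorbs the constant. -/
theorem of_stubs (h₁ : CellDictionary) (h₂ : MomentFeasibility) (h₃ : PseudoMomentBound) :
    ∃ c : ℝ, 0 < c ∧ ∃ s₀ : ℕ, ∀ p : ℕ, p.Prime → ∀ (n s : ℕ) (A B : Fin n → Finset (ZMod p)), s₀ ≤ s →
      (∀ i : Fin n, (A i).card = s ∧ (B i).card = s) →
      (∀ i : Fin n, ∀ a ∈ A i, ∀ a' ∈ A i, ∀ b ∈ B i, ∀ b' ∈ B i,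
        (a - a') + (b - b') = 0 → a = a' ∧ b = b') →
      (∀ i j k : Fin n, ∀ a ∈ A i, ∀ a' ∈ A j, ∀ b ∈ B j, ∀ b' ∈ B k,
        (a - a') + (b - b') = 0 → i = k) →
      (n : ℝ) * (s : ℝ) ^ (1 + c) ≤ (p : ℝ) := by
  obtain ⟨d, C, c, hc, hB⟩ := h₃
  obtain ⟨s₁, hs₁⟩ := exists_threshold C c hc
  refine ⟨c / 2, by linarith, max 1 s₁, ?_⟩
  intro p hp n s A B hs hbal hW hX
  haveI : NeZero p := ⟨hp.ne_zero⟩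
  have hs1 : 1 ≤ s := le_trans (le_max_left _ _) hs
  have hC : C ≤ (s : ℝ) ^ (c / 2) := hs₁ s (le_trans (le_max_right _ _) hs)
  have hgood : GoodCells p n s (cells A B) := h₁ p n s A B hbal hW hX
  have hfeas : Feasible d p n s (trueMoment (cells A B)) := h₂ p n s _ hgood d
  have hbound : (n : ℝ) * (s : ℝ) ^ (1 + c) ≤ C * p := hB p hp n s _ hfeas
  exact absorb_constant n s p C c hs1 hC hbound

/-- **`PrimeCyclicPowerGain` from the three stubs** — concludes the crux BY NAME. -/
theorem PrimeCyclicPowerGain_of :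
    Summit.MatrixMultiplication.MatrixMultiplication.Theses.FourierTwoFamiliesModP.PrimeCyclicPowerGain :=
  of_stubs stub_cells stub_moments stub_sos

end Summit.MatrixMultiplication.MatrixMultiplication.Cruxes.PrimeCyclicPowerGain.SosFlatnessCertificate

end
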